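import Summits.QuantumFields.YangMills.Theorems.VirialFluxGapRingTreeGauge
import Summits.QuantumFields.YangMills.Theorems.VirialFluxGapDeficitForm
import HarnessLib

/-!
# Route `VirialFluxGap` (YangMills): the Gibbs mean and the sublevel volumes of the zero-flux ring deficit in TREE GAUGE —
# exact transfer to the reduced product group `X_fix = SU(2)^{off-tree} × (slices 1…2L−1) × (seam)`

Toward the deciding crux `VirialFluxGap.PeriodicSoftness` (item stmt-QuantumFields-24141).  The virial ∕ IBP reduction
✓`EulerFieldReduction.periodicSoftness_of_eulerField` (w3 g58) asks for an Euler-type coefficient field on the FULL ring space `Ω` with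
`div X ≤ 18L⁴ − 2c₁`; there the per-variable radial profile alone has divergence `3·(6L⁴ + L³) = 18L⁴ + 3L³`, so the `3L³` GAUGE directions
would have to carry weight `0` — a non-local (Faddeev–Popov) projector.  In the TREE GAUGE of slice `0` only the residual constant `SU(2)`
survives, and the toron valley is the explicit 6-parameter comb family (✓`RegularValley.ringDeficit_eq_zero_iff_comb`).  This file transfers
the two Gibbs integrals AND the sublevel volumes EXACTLY to the reduced product group
`X_fix = (OffIdx L → SU2) × ((Fin (2L−1) → GaugeConfig 3 L SU2) × (Site 3 L → SU2))` with product Haar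
`μ_fix = Haar^{off} ⊗ ((⊗_j configMeasure) ⊗ gaugeMeasure)` and the reduced deficit `F_fix(w, r) = F₀(glue w ∷ r)`
(✓`RingDeficit.integral_ringMeasure_eq_treeGauge`, w2 g49, + Fubini):

* `integral_ringMeasure_eq_integral_fix` — `∫ G dμ_L = ∫ G(glue w ∷ r) dμ_fix` for every bounded measurable gauge-invariant `G ≥ 0`;
* `integral_exp_eq_fix` ∕ `integral_mul_exp_eq_fix` ∕ `measureReal_deficit_le_eq_fix` — the two Gibbs integrals and `μ{F₀ ≤ s}`;
* ★★ `gibbsMean_eq_fix` — `β·∫F₀e^{−βF₀}dμ_L / ∫e^{−βF₀}dμ_L = β·∫F_fix e^{−βF_fix}dμ_fix / ∫e^{−βF_fix}dμ_fix` for every `β`: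
  the Euler field may be built on `X_fix` (w3's generic engine ✓`HaarIBP` applies to any group with a right-invariant finite measure), where
  NO gauge projector is needed.

HONEST FRAMING: measure-theoretic bookkeeping; the Euler field is NOT constructed; ⟨24141⟩ stays OPEN; the Yang–Mills mass gap is NOT proved;
no summit is proved by a line.  ROUTE-INDEPENDENT.  THEOREMS ONLY (no definition, no `sorry`), standard axioms.  Width seat
`ym-line-sfw-p2-w2` g51 (cell ym-idea-1, free hands), `--supports stmt-QuantumFields-24141`.  References: [cite: SeilerLNP1982, §2];
[cite: MontvayMunster1994, (3.145)].
-/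

set_option autoImplicit false

noncomputable section

open MeasureTheory Filter Set Function
open scoped BigOperators Topology ENNReal
open Literature.MathematicalPhysics.QuantumFieldTheory hiding SU2
open Literature.MathematicalPhysics.QuantumLattice

namespace Summit.QuantumFields.YangMills.Theorems.VirialFluxGap.TreeGaugeTransfer

open Summit.QuantumFields.YangMills.Theorems.FemtoTransferGap
open Summit.QuantumFields.YangMills.Theorems.FemtoTransferGap.TT
open Summit.QuantumFields.YangMills.Theorems.VirialFluxGap.RingDeficit

variable {L : ℕ} [NeZero L]

omit [NeZero L] in
/-- The pull-back of a measurable functional to the reduced space is measurable. [folklore] -/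
theorem measurable_comp_fix {α : Type*} [MeasurableSpace α]
    {G : (Fin (2 * L - 1 + 1) → GaugeConfig 3 L SU2) × (Site 3 L → SU2) → α} (hG : Measurable G) :
    Measurable fun x : (OffIdx L → SU2) × ((Fin (2 * L - 1) → GaugeConfig 3 L SU2) × (Site 3 L → SU2)) =>
      G ((Fin.cons (glue x.1) x.2.1 : Fin (2 * L - 1 + 1) → GaugeConfig 3 L SU2), x.2.2) :=
  hG.comp ((measurable_ringCons (L := L)).comp ((measurable_glue.comp measurable_fst).prodMk measurable_snd))

/-- ★ **The ring integral of a bounded measurable gauge-invariant functional equals its integral over the reduced product group**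
`X_fix` with product Haar (✓`integral_ringMeasure_eq_treeGauge` + Fubini). [cite: SeilerLNP1982, §2] -/
theorem integral_ringMeasure_eq_integral_fix
    {G : (Fin (2 * L - 1 + 1) → GaugeConfig 3 L SU2) × (Site 3 L → SU2) → ℝ} (hG : Measurable G)
    (hinv : ∀ (h : Site 3 L → SU2) (p : (Fin (2 * L - 1 + 1) → GaugeConfig 3 L SU2) × (Site 3 L → SU2)),
      G ((fun i => gaugeTransform h (p.1 i)), h * p.2 * h⁻¹) = G p)
    (h0 : ∀ p, 0 ≤ G p) {C : ℝ} (hC : ∀ p, G p ≤ C) :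
    ∫ p, G p ∂(ringMeasure L) =
      ∫ x, G ((Fin.cons (glue x.1) x.2.1 : Fin (2 * L - 1 + 1) → GaugeConfig 3 L SU2), x.2.2)
        ∂((Measure.pi fun _ : OffIdx L => haarProbability SU2).prod
          ((Measure.pi fun _ : Fin (2 * L - 1) => configMeasure SU2 L).prod (gaugeMeasure L))) := by
  haveI : IsProbabilityMeasure (gaugeMeasure L) := isProbabilityMeasure_gaugeMeasure (L := L)
  rw [integral_ringMeasure_eq_treeGauge hG hinv h0 hC]
  symm
  refine integral_prod (f := fun x : (OffIdx L → SU2) × ((Fin (2 * L - 1) → GaugeConfig 3 L SU2) × (Site 3 L → SU2)) =>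
    G ((Fin.cons (glue x.1) x.2.1 : Fin (2 * L - 1 + 1) → GaugeConfig 3 L SU2), x.2.2)) ?_
  refine Integrable.of_bound (measurable_comp_fix hG).aestronglyMeasurable C (ae_of_all _ fun x => ?_)
  rw [Real.norm_eq_abs, abs_of_nonneg (h0 _)]
  exact hC _

/-- Gauge invariance of `e^{−βF₀}`. [folklore] -/
theorem exp_neg_mul_ringDeficit_invariant (β : ℝ) (h : Site 3 L → SU2)
    (p : (Fin (2 * L - 1 + 1) → GaugeConfig 3 L SU2) × (Site 3 L → SU2)) :
    Real.exp (-(β * ringDeficit L (fun _ => false) ((fun i => gaugeTransform h (p.1 i)), h * p.2 * h⁻¹))) =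
      Real.exp (-(β * ringDeficit L (fun _ => false) p)) := by
  rw [ringDeficit_ringGaugeAct]

/-- ★ **Transfer of `∫ e^{−βF₀}`** (`β ≥ 0`). [cite: SeilerLNP1982, §2] -/
theorem integral_exp_eq_fix {β : ℝ} (hβ : 0 ≤ β) :
    ∫ p, Real.exp (-(β * ringDeficit L (fun _ => false) p)) ∂(ringMeasure L) =
      ∫ x, Real.exp (-(β * ringDeficit L (fun _ => false)
          ((Fin.cons (glue x.1) x.2.1 : Fin (2 * L - 1 + 1) → GaugeConfig 3 L SU2), x.2.2)))
        ∂((Measure.pi fun _ : OffIdx L => haarProbability SU2).prod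
          ((Measure.pi fun _ : Fin (2 * L - 1) => configMeasure SU2 L).prod (gaugeMeasure L))) := by
  refine integral_ringMeasure_eq_integral_fix (G := fun p => Real.exp (-(β * ringDeficit L (fun _ => false) p)))
    ((measurable_ringDeficit _).const_mul β |>.neg.exp) (fun h p => exp_neg_mul_ringDeficit_invariant β h p)
    (fun p => (Real.exp_pos _).le) (C := 1) fun p => ?_
  exact Real.exp_le_one_iff.mpr (by have := ringDeficit_nonneg (L := L) (fun _ => false) p; nlinarith)

/-- ★ **Transfer of `∫ F₀ e^{−βF₀}`** (`β ≥ 0`; `F₀ e^{−βF₀} ≤ 12L⁴ + |min Φ|`-type bound via ✓`exists_abs_ringDeficit_le`). [cite: SeilerLNP1982, §2] -/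
theorem integral_mul_exp_eq_fix {β : ℝ} (hβ : 0 ≤ β) :
    ∫ p, ringDeficit L (fun _ => false) p * Real.exp (-(β * ringDeficit L (fun _ => false) p)) ∂(ringMeasure L) =
      ∫ x, ringDeficit L (fun _ => false) ((Fin.cons (glue x.1) x.2.1 : Fin (2 * L - 1 + 1) → GaugeConfig 3 L SU2), x.2.2) *
          Real.exp (-(β * ringDeficit L (fun _ => false)
            ((Fin.cons (glue x.1) x.2.1 : Fin (2 * L - 1 + 1) → GaugeConfig 3 L SU2), x.2.2)))
        ∂((Measure.pi fun _ : OffIdx L => haarProbability SU2).prod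
          ((Measure.pi fun _ : Fin (2 * L - 1) => configMeasure SU2 L).prod (gaugeMeasure L))) := by
  obtain ⟨B, hB⟩ := exists_abs_ringDeficit_le (L := L) (fun _ => false)
  refine integral_ringMeasure_eq_integral_fix
    (G := fun p => ringDeficit L (fun _ => false) p * Real.exp (-(β * ringDeficit L (fun _ => false) p)))
    ((measurable_ringDeficit _).mul ((measurable_ringDeficit _).const_mul β |>.neg.exp))
    (fun h p => by simp only [ringDeficit_ringGaugeAct])
    (fun p => mul_nonneg (ringDeficit_nonneg _ _) (Real.exp_pos _).le) (C := B) fun p => ?_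
  have h1 : Real.exp (-(β * ringDeficit L (fun _ => false) p)) ≤ 1 :=
    Real.exp_le_one_iff.mpr (by have := ringDeficit_nonneg (L := L) (fun _ => false) p; nlinarith)
  calc ringDeficit L (fun _ => false) p * Real.exp (-(β * ringDeficit L (fun _ => false) p))
      ≤ ringDeficit L (fun _ => false) p * 1 := mul_le_mul_of_nonneg_left h1 (ringDeficit_nonneg _ _)
    _ ≤ B := by rw [mul_one]; exact (le_abs_self _).trans (hB p)

/-- ★ **Transfer of the sublevel volumes**: `μ_L{F₀ ≤ s} = μ_fix{F_fix ≤ s}`. [cite: SeilerLNP1982, §2] -/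
theorem measureReal_deficit_le_eq_fix (s : ℝ) :
    (ringMeasure L).real {p | ringDeficit L (fun _ => false) p ≤ s} =
      ((Measure.pi fun _ : OffIdx L => haarProbability SU2).prod
          ((Measure.pi fun _ : Fin (2 * L - 1) => configMeasure SU2 L).prod (gaugeMeasure L))).real
        {x | ringDeficit L (fun _ => false) ((Fin.cons (glue x.1) x.2.1 : Fin (2 * L - 1 + 1) → GaugeConfig 3 L SU2), x.2.2) ≤ s} := by
  haveI : IsProbabilityMeasure (gaugeMeasure L) := isProbabilityMeasure_gaugeMeasure (L := L)
  haveI := isProbabilityMeasure_ringMeasure (L := L)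
  have hS : MeasurableSet {p : (Fin (2 * L - 1 + 1) → GaugeConfig 3 L SU2) × (Site 3 L → SU2) | ringDeficit L (fun _ => false) p ≤ s} :=
    measurableSet_le (measurable_ringDeficit _) measurable_const
  have hS' : MeasurableSet {x : (OffIdx L → SU2) × ((Fin (2 * L - 1) → GaugeConfig 3 L SU2) × (Site 3 L → SU2)) |
      ringDeficit L (fun _ => false) ((Fin.cons (glue x.1) x.2.1 : Fin (2 * L - 1 + 1) → GaugeConfig 3 L SU2), x.2.2) ≤ s} :=
    measurableSet_le (measurable_comp_fix (measurable_ringDeficit _)) measurable_const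
  -- both sides are integrals of the indicator
  have h := integral_ringMeasure_eq_integral_fix (L := L)
    (G := fun p => ({p | ringDeficit L (fun _ => false) p ≤ s} : Set _).indicator (fun _ => (1 : ℝ)) p)
    ((measurable_const.indicator hS)) (fun h p => by
      simp only [Set.indicator_apply, Set.mem_setOf_eq, ringDeficit_ringGaugeAct])
    (fun p => Set.indicator_nonneg (fun _ _ => zero_le_one) _) (C := 1)
    (fun p => Set.indicator_le_self' (fun _ _ => zero_le_one) _)
  rw [integral_indicator hS, setIntegral_const, smul_eq_mul, mul_one] at h
  rw [h]
  have e : (fun x : (OffIdx L → SU2) × ((Fin (2 * L - 1) → GaugeConfig 3 L SU2) × (Site 3 L → SU2)) =>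
      ({p : (Fin (2 * L - 1 + 1) → GaugeConfig 3 L SU2) × (Site 3 L → SU2) | ringDeficit L (fun _ => false) p ≤ s} : Set _).indicator
        (fun _ => (1 : ℝ)) ((Fin.cons (glue x.1) x.2.1 : Fin (2 * L - 1 + 1) → GaugeConfig 3 L SU2), x.2.2)) =
      ({x : (OffIdx L → SU2) × ((Fin (2 * L - 1) → GaugeConfig 3 L SU2) × (Site 3 L → SU2)) |
        ringDeficit L (fun _ => false) ((Fin.cons (glue x.1) x.2.1 : Fin (2 * L - 1 + 1) → GaugeConfig 3 L SU2), x.2.2) ≤ s} : Set _).indicator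
        fun _ => (1 : ℝ) := by
    funext x
    simp only [Set.indicator_apply, Set.mem_setOf_eq]
  rw [e, integral_indicator hS', setIntegral_const, smul_eq_mul, mul_one]

/-- ★★ **The Gibbs mean of the zero-flux deficit is the Gibbs mean of the reduced deficit on `X_fix`** (`β ≥ 0`). [cite: MontvayMunster1994, (3.145)] -/
theorem gibbsMean_eq_fix {β : ℝ} (hβ : 0 ≤ β) :
    β * (∫ p, ringDeficit L (fun _ => false) p * Real.exp (-(β * ringDeficit L (fun _ => false) p)) ∂(ringMeasure L)) /
        (∫ p, Real.exp (-(β * ringDeficit L (fun _ => false) p)) ∂(ringMeasure L)) =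
      β * (∫ x, ringDeficit L (fun _ => false) ((Fin.cons (glue x.1) x.2.1 : Fin (2 * L - 1 + 1) → GaugeConfig 3 L SU2), x.2.2) *
            Real.exp (-(β * ringDeficit L (fun _ => false)
              ((Fin.cons (glue x.1) x.2.1 : Fin (2 * L - 1 + 1) → GaugeConfig 3 L SU2), x.2.2)))
          ∂((Measure.pi fun _ : OffIdx L => haarProbability SU2).prod
            ((Measure.pi fun _ : Fin (2 * L - 1) => configMeasure SU2 L).prod (gaugeMeasure L)))) /
        (∫ x, Real.exp (-(β * ringDeficit L (fun _ => false)
            ((Fin.cons (glue x.1) x.2.1 : Fin (2 * L - 1 + 1) → GaugeConfig 3 L SU2), x.2.2)))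
          ∂((Measure.pi fun _ : OffIdx L => haarProbability SU2).prod
            ((Measure.pi fun _ : Fin (2 * L - 1) => configMeasure SU2 L).prod (gaugeMeasure L)))) := by
  rw [integral_exp_eq_fix hβ, integral_mul_exp_eq_fix hβ]

end Summit.QuantumFields.YangMills.Theorems.VirialFluxGap.TreeGaugeTransfer

end
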